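import Summits.ABC.IUTFork.Joshi.TestRealPinsHonestCarrierY26AnalogueForms
import Summits.ABC.IUTFork.Joshi.TestGenuinePinsCriterionAnyThetaIdeles
import HarnessLib

/-!
# Branch E TEST (R-J row Y-26, E-ROW R-82) — THE HONEST-CARRIER Y-26 CRITERION FOR EVERY BOX CENTRE: the binder `[Fact p.Prime]`
# on the Θ-box centre `p` of `honestSetting … col n p` REMOVED (zero centre allowed; count-neutral hygiene)

Proof-only file (abc-iut cell, block E, rung LADDER-ABC:A2.E; E-ROW R-82 «any-Θ at the honest carrier»; seat abc-iut-E-t27, GEN 12;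
0 definitions, 0 instances, 0 notation, no `Prop` fact, FACT rows used: none; everything BY NAME).

LOCATED FIRST.  abc-iut-E-t41's honest carrier `honestSetting X hlog Aut Ism hAut hIsm … col n p` (p440805) has NO Θ-ideles slot: its
Θ-boxes are the printed-shape constants `e⁻¹(p·𝒪_L)` with ONE centre `p : ℕ`, its `q`-box is `e⁻¹(𝒪_L)`, and it is defined for EVERY `p : ℕ`
(kernel signature `… (col) → ℤ → ℕ → Cor312.Setting …`, no `Fact`).  The «non-zero Θ-ideles» proviso `ht0` of p503923 / p504878 therefore has
ONE twin here: the binder **`[hp : Fact p.Prime]`** of ★ p525961's `HonestPinsY26.exists_pinnedRegions_honestSetting_DH_iff_finrank_eq_one`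
(and of the ★ p527102 Forms), inherited from the INHABITED side only (p449694 `PinsInhabited.exists_pinnedRegions_honestSetting_of_unitMultiplications`),
where it is consumed ONLY as `hp.out.ne_zero : p ≠ 0` — the non-degeneracy `hc : c ≠ 0` of p448218's `preimage_dEquiv_hullSet_natCast` /
`preimage_factorMapDH_hullSet_natCast` / `permute_image_hullSet_natCast`, i.e. Literature's `hullSet_eq_image_mul … (hc : ∀ j, c j ≠ 0)`; the
EMPTY side never had it — the honest twin of ★ p527356's diagnosis at `settingPrVolSharp` (`boxOf_smul_normalizedPacket`'s non-degeneracy).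

THIS FILE transports ★ p527356's §0 (`GenuinePinsAnyTheta.hullSet_eq_image_mul_polydisc`, `λ·𝒪_L = {λ·x}` for EVERY centre) and re-derives
E-t41/E-t58's inhabited chain with the centre hypothesis deleted: §0 `preimage_dEquiv_hullSet_natCast₀` (every `c : ℕ`); §1 (c312-5's generic
real shells) `preimage_factorMapDH_hullSet_natCast₀`, `permute_image_hullSet_natCast₀`, `factorwise_image_hullSet_natCast_of_unitIsm₀`,
`generator_image_hullSet_natCast_of_unitIsm₀` (p448218 / p449694 VERBATIM minus `hc`); §2 `…_of_unitIsm_forall_centre`,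
`…_of_unitMultiplications_forall_centre` (centre universally quantified AFTER the hypotheses; no primality); §3 (Dupuy–Hilado binders):
**`forall_centre_exists_pinnedRegions_honestSetting_DH_iff_finrank_eq_one`** `(∀ p, ∃ ρ qK, PinnedRegions … p …) ↔ [F:ℚ] = 1`, `exists_centre_…`
`(∃ p ρ qK, …) ↔ [F:ℚ] = 1` (CENTRE-INDEPENDENCE), the three-pin `forall_centre_exists_pinnedRegions3_…` (★ p524924's `Fact`-free
`HonestPinsLinkPin.exists_pinnedRegions3_honestSetting_iff`), and the ZERO-CENTRE instance `exists_pinnedRegions_honestSetting_DH_zeroCentre_iff_finrank_eq_one`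
(Θ-boxes `e⁻¹(0·𝒪_L)`) — the honest twin of «zero Θ-idele coordinates allowed».  (The per-centre `↔` at ONE arbitrary `p` is `exists_centre_…` ∘
`forall_centre_…`; it is not filed separately: modulo the instance binder `[Fact p.Prime]` it IS ★ p525961's statement, and the gate's
dedup check identifies the two.)

READING (tree currency; located, not adjudicated; COUNT-NEUTRAL).  «Honest pins over the DH binders INHABITED ⟺ F = ℚ» holds at EVERY box centre,
prime or not, zero included; the `[Fact p.Prime]` of ★ p525961 / ★ p527102 is a proof artefact of the inhabited side, exactly as `ht0` was at the
genuine carrier (★ p527356); PROPOSED word (ii) needs no proviso on either carrier.  (At `p = 0` p440805's honest-exponent VOLUME story is void —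
the PINS read regions, not volumes; binder hygiene of OUR criterion, nothing about print.)  **No side is taken** on [IUTchIII] Cor. 3.12 /
[IUTchIV] Thm. 1.10 or on any author (Mochizuki / Scholze–Stix / Joshi / Dupuy–Hilado); typed ≠ proved; instantiated ≠ endorsed; NOT an abc claim.
[claim: Mochizuki2012, status: disputed] [cite: DupuyHilado2025, §4.7, §4.9] [cite: Mochizuki2012, IUTchIII Rmk. 3.9.5 (i) p. 127; IUTchIV Prop. 1.4 (i) p. 13]
-/

noncomputable section

open Set Function NumberField IsDedekindDomain Metric Module
open scoped Pointwise

namespace Summit.ABC.IUTFork.Joshi.HonestPinsAnyCentre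

open Summit.ABC.IUTFork.Joshi Summit.ABC.IUTFork Thm311 Thm311.Real Cor312 Cor312Vol Literature.IUT.LogThetaLattice
  Literature.IUT.LogVolume Literature.IUT.HodgeTheaters Literature.NumberTheory.NumberFields
open PinsInhabited GenuinePinsAnyTheta HonestPinsY26 IsmDHFixesEverywhere

/-! ## 0. `ψ⁻¹(c·𝒪_L) = c·(R_I)^∼` for EVERY natural number `c` -/

section Prime

variable (p : ℕ) [hp : Fact p.Prime] {I : Type} [Fintype I] [DecidableEq I] [Nonempty I]
  (k : I → Type) [∀ i, NontriviallyNormedField (k i)] [∀ i, NormedAlgebra ℚ_[p] (k i)]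
  [∀ i, IsUltrametricDist (k i)] [∀ i, ProperSpace (k i)]

/-- **`ψ⁻¹(c·𝒪_L) = c·(R_I)^∼` for EVERY `c : ℕ`** (p448218's `preimage_dEquiv_hullSet_natCast` minus `hn : n ≠ 0`, via ★ p527356's
`hullSet_eq_image_mul_polydisc`; at `c = 0` both sides are `{0}`-shaped). [cite: Mochizuki2012, IUTchIV Prop. 1.4 (i) p. 13] -/
theorem preimage_dEquiv_hullSet_natCast₀ (c : ℕ) :
    dEquiv p k ⁻¹' hullSet (DFac p k) (fun j => (c : DFac p k j)) =
      (c : PacketAlgebra p k) • (normalizedPacket p k : Set (PacketAlgebra p k)) := by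
  have hg : dEquiv p k (c : PacketAlgebra p k) = fun j => (c : DFac p k j) := by
    rw [map_natCast]; rfl
  rw [← Set.preimage_image_eq ((c : PacketAlgebra p k) • (normalizedPacket p k : Set (PacketAlgebra p k))) (dEquiv p k).injective,
    image_smul_eq, image_normalizedPacket_eq_coe, coe_piUnitBallStructure, hg, hullSet_eq_image_mul_polydisc]

end Prime

/-! ## 1. c312-5's generic real shells: the centre hypothesis deleted from p448218 / p449694 -/

section Shells

variable {F : Type} [Field F] [NumberField F] (X : PilotData F) {logv : PadicLogs F} (hlog : LogvAnalytic logv)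
  (Aut Ism : ∀ x : Thm311.Real.Place F, Set (Carrier x ≃ₗ[ℚ] Carrier x))
  (hAut : ∀ x, LinearEquiv.refl ℚ (Carrier x) ∈ Aut x) (hIsm : ∀ x, LinearEquiv.refl ℚ (Carrier x) ∈ Ism x)

/-- **`e⁻¹(c·𝒪_L) = comparison⁻¹(Π_{v⃗} c·(R_{v⃗})^∼)` at every prime packet, for EVERY `c : ℕ`** (p448218 minus `hc`).
[cite: Mochizuki2012, IUTchIV Prop. 1.4 (i) p. 13] -/
theorem preimage_factorMapDH_hullSet_natCast₀ (j : (thetaIndex X).Label) (pp : Nat.Primes) (c : ℕ) :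
    haveI : Fact (pp : ℕ).Prime := ⟨pp.2⟩
    (fun x : (logShells X logv Aut Ism hAut hIsm).Packet j (.inr pp) => factorMapDH X hlog j (.inr pp) x) ⁻¹'
        hullSet (factorFieldDH X hlog j (.inr pp)) (fun s => (c : factorFieldDH X hlog j (.inr pp) s)) =
      (presAt X hlog pp).comparison j ⁻¹' Set.pi univ fun e =>
        (c : (presAt X hlog pp).X e) • (normalizedPacket (pp : ℕ) ((presAt X hlog pp).kk e) : Set ((presAt X hlog pp).X e)) := by
  haveI : Fact (pp : ℕ).Prime := ⟨pp.2⟩; haveI : Nonempty ((thetaIndex X).Caps j) := ⟨0⟩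
  refine Eq.trans (b := (fun x => (presAt X hlog pp).factorMap j x) ⁻¹'
    hullSet ((presAt X hlog pp).factorField j) (fun s => (c : (presAt X hlog pp).factorField j s))) rfl ?_
  rw [PadicPresentation.factorMap_preimage_hullSet]
  exact congrArg (fun R : ∀ e, Set ((presAt X hlog pp).X e) => ((presAt X hlog pp).comparison j : _ → _) ⁻¹' Set.pi univ R)
    (funext fun e => preimage_dEquiv_hullSet_natCast₀ (pp : ℕ) ((presAt X hlog pp).kk e) c)

/-- **Every capsule permutation FIXES `e⁻¹(c·𝒪_L)`**, every `c : ℕ` (p448218 minus `hc`). [cite: DupuyHilado2025, §4.7] -/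
theorem permute_image_hullSet_natCast₀ (j : (thetaIndex X).Label) (pp : Nat.Primes) (c : ℕ)
    (σ : Equiv.Perm ((thetaIndex X).Caps j)) :
    (logShells X logv Aut Ism hAut hIsm).permute j (.inr pp) σ ''
        ((fun x : (logShells X logv Aut Ism hAut hIsm).Packet j (.inr pp) => factorMapDH X hlog j (.inr pp) x) ⁻¹'
          hullSet (factorFieldDH X hlog j (.inr pp)) (fun s => (c : factorFieldDH X hlog j (.inr pp) s))) =
      (fun x : (logShells X logv Aut Ism hAut hIsm).Packet j (.inr pp) => factorMapDH X hlog j (.inr pp) x) ⁻¹'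
        hullSet (factorFieldDH X hlog j (.inr pp)) (fun s => (c : factorFieldDH X hlog j (.inr pp) s)) := by
  haveI : Fact (pp : ℕ).Prime := ⟨pp.2⟩; haveI : Nonempty ((thetaIndex X).Caps j) := ⟨0⟩
  have hperm : ∀ (τ : Equiv.Perm ((thetaIndex X).Caps j)) (e : (thetaIndex X).Caps j → (thetaIndex X).Fibre (.inr pp)),
      (presAt X hlog pp).permX τ e ''
          ((c : (presAt X hlog pp).X (e ∘ τ)) •
            (normalizedPacket (pp : ℕ) ((presAt X hlog pp).kk (e ∘ τ)) : Set ((presAt X hlog pp).X (e ∘ τ)))) =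
        (c : (presAt X hlog pp).X e) • (normalizedPacket (pp : ℕ) ((presAt X hlog pp).kk e) : Set ((presAt X hlog pp).X e)) :=
    fun τ e => by
      show ⇑(permAlgEquiv (pp : ℕ) ((presAt X hlog pp).kk e) τ) ''
          ((c : PacketAlgebra (pp : ℕ) fun i => (presAt X hlog pp).kk e (τ i)) •
            (normalizedPacket (pp : ℕ) (fun i => (presAt X hlog pp).kk e (τ i)) : Set _)) = _
      rw [Set.image_smul_distrib, image_normalizedPacket_perm, map_natCast]
  have key := (presAt X hlog pp).permute_image_preimage_pi
    (fun e => (c : (presAt X hlog pp).X e) • (normalizedPacket (pp : ℕ) ((presAt X hlog pp).kk e) : Set ((presAt X hlog pp).X e)))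
    hperm σ
  rw [preimage_factorMapDH_hullSet_natCast₀ X hlog Aut Ism hAut hIsm j pp c]
  exact key

variable {Aut Ism}

/-- **Every (Ind2)-generator FIXES `e⁻¹(c·𝒪_L)` at every prime packet, every `c : ℕ`**, when `Ism` acts by norm-one units (p449694's
`factorwise_image_hullSet_natCast_of_unitIsm` VERBATIM minus `hc`: the unit `⊗_a c_{a,v⃗(a)}` fixes `c·(R_{v⃗})^∼`, `c = 0` included). [cite: DupuyHilado2025, §4.9] -/
theorem factorwise_image_hullSet_natCast_of_unitIsm₀
    (hIsmU : ∀ (pp : Nat.Primes) (x : (thetaIndex X).Fibre (.inr pp)), ∀ g ∈ Ism x.1,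
      haveI : Fact (pp : ℕ).Prime := ⟨pp.2⟩
      ∃ c : (presAt X hlog pp).k x, ‖c‖ = 1 ∧ ∀ a, (presAt X hlog pp).φ x (g a) = c * (presAt X hlog pp).φ x a)
    (j : (thetaIndex X).Label) (pp : Nat.Primes) (c : ℕ)
    (g : (thetaIndex X).Caps j → ∀ x : (thetaIndex X).Fibre (.inr pp),
      (logShells X logv Aut Ism hAut hIsm).carrier x.1 ≃ₗ[ℚ] (logShells X logv Aut Ism hAut hIsm).carrier x.1)
    (hg : ∀ i x, g i x ∈ Ism x.1) :
    (logShells X logv Aut Ism hAut hIsm).factorwise j (.inr pp)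
          (fun i => (logShells X logv Aut Ism hAut hIsm).summandwise (.inr pp) (g i)) ''
        ((fun x : (logShells X logv Aut Ism hAut hIsm).Packet j (.inr pp) => factorMapDH X hlog j (.inr pp) x) ⁻¹'
          hullSet (factorFieldDH X hlog j (.inr pp)) (fun s => (c : factorFieldDH X hlog j (.inr pp) s))) =
      (fun x : (logShells X logv Aut Ism hAut hIsm).Packet j (.inr pp) => factorMapDH X hlog j (.inr pp) x) ⁻¹'
        hullSet (factorFieldDH X hlog j (.inr pp)) (fun s => (c : factorFieldDH X hlog j (.inr pp) s)) := by
  haveI : Fact (pp : ℕ).Prime := ⟨pp.2⟩; haveI : Nonempty ((thetaIndex X).Caps j) := ⟨0⟩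
  choose cc hcc1 hccφ using fun i x => hIsmU pp x (g i x) (hg i x)
  have hcc0 : ∀ i x, cc i x ≠ 0 := fun i x h => by
    have := hcc1 i x; rw [h, norm_zero] at this; exact zero_ne_one this
  -- the `ℚ_p`-linear unit multiplications in the presented fields
  let g' : (thetaIndex X).Caps j → ∀ x : (thetaIndex X).Fibre (.inr pp), (presAt X hlog pp).k x ≃ₗ[ℚ_[pp]] (presAt X hlog pp).k x :=
    fun i x => (LinearEquiv.smulOfNeZero ((presAt X hlog pp).k x) ((presAt X hlog pp).k x) (cc i x) (hcc0 i x)).restrictScalars ℚ_[pp]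
  have hg' : ∀ i x a, (presAt X hlog pp).φ x (g i x a) = g' i x ((presAt X hlog pp).φ x a) := fun i x a =>
    (hccφ i x a).trans rfl
  have key := image_preimage_eq_of_semiconj
    ((logShells X logv Aut Ism hAut hIsm).factorwise j (.inr pp)
      (fun i => (logShells X logv Aut Ism hAut hIsm).summandwise (.inr pp) (g i))).surjective
    (Ψ := fun (y : ∀ e : (thetaIndex X).Caps j → (thetaIndex X).Fibre (.inr pp), (presAt X hlog pp).X e) e =>
      (PiTensorProduct.congr fun a => g' a (e a) : (presAt X hlog pp).X e ≃ₗ[ℚ_[pp]] (presAt X hlog pp).X e) (y e))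
    (fun y y' h => funext fun e =>
      (PiTensorProduct.congr fun a => g' a (e a) : (presAt X hlog pp).X e ≃ₗ[ℚ_[pp]] (presAt X hlog pp).X e).injective
        (congrFun h e))
    ((presAt X hlog pp).comparison_factorwise g g' hg')
    (Λ := Set.pi univ fun e => (c : (presAt X hlog pp).X e) •
      (normalizedPacket (pp : ℕ) ((presAt X hlog pp).kk e) : Set ((presAt X hlog pp).X e))) ?_
  · rw [preimage_factorMapDH_hullSet_natCast₀ X hlog Aut Ism hAut hIsm j pp c]
    exact key
  -- the summandwise map fixes the product family summand by summand
  rw [show (fun (y : ∀ e : (thetaIndex X).Caps j → (thetaIndex X).Fibre (.inr pp), (presAt X hlog pp).X e) e =>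
      (PiTensorProduct.congr fun a => g' a (e a) : (presAt X hlog pp).X e ≃ₗ[ℚ_[pp]] (presAt X hlog pp).X e) (y e)) =
      Pi.map (fun e => ⇑(PiTensorProduct.congr fun a => g' a (e a) :
        (presAt X hlog pp).X e ≃ₗ[ℚ_[pp]] (presAt X hlog pp).X e)) from rfl, Set.piMap_image_univ_pi]
  refine congrArg (Set.pi univ) (funext fun e => ?_)
  have hfun : (⇑(PiTensorProduct.congr fun a => g' a (e a) : (presAt X hlog pp).X e ≃ₗ[ℚ_[pp]] (presAt X hlog pp).X e)) =
      fun v => purePacket (pp : ℕ) ((presAt X hlog pp).kk e) (fun a => cc a (e a)) * v :=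
    funext fun v => congr_smul_eq_purePacket_mul (pp : ℕ) ((presAt X hlog pp).kk e) (fun a => cc a (e a))
      (fun a => hcc0 a (e a)) v
  rw [hfun]
  exact purePacket_mul_image_smul_normalizedPacket (pp : ℕ) ((presAt X hlog pp).kk e) _ (fun a => hcc1 a (e a)) _

/-- **Every generator fixes `e⁻¹(c·𝒪_L)` at every packet, every `c : ℕ`** (trivial strip binder, unit-multiplication `Ism`; p449694's
`generator_image_hullSet_natCast_of_unitIsm` VERBATIM minus `hc`). [cite: DupuyHilado2025, §4.7, §4.9] -/
theorem generator_image_hullSet_natCast_of_unitIsm₀ (hAutT : ∀ x, ∀ g ∈ Aut x, g = LinearEquiv.refl ℚ (Carrier x))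
    (hIsmU : ∀ (pp : Nat.Primes) (x : (thetaIndex X).Fibre (.inr pp)), ∀ g ∈ Ism x.1,
      haveI : Fact (pp : ℕ).Prime := ⟨pp.2⟩
      ∃ c : (presAt X hlog pp).k x, ‖c‖ = 1 ∧ ∀ a, (presAt X hlog pp).φ x (g a) = c * (presAt X hlog pp).φ x a)
    (c : ℕ) {Φ : (logShells X logv Aut Ism hAut hIsm).PacketAut}
    (hΦ : Φ ∈ (logShells X logv Aut Ism hAut hIsm).Ind1Family ∪ (logShells X logv Aut Ism hAut hIsm).Ind2Family)
    (j : (thetaIndex X).Label) (vQ : (thetaIndex X).VQ) :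
    Φ j vQ '' ((fun x : (logShells X logv Aut Ism hAut hIsm).Packet j vQ => factorMapDH X hlog j vQ x) ⁻¹'
        hullSet (factorFieldDH X hlog j vQ) (fun s => (c : factorFieldDH X hlog j vQ s))) =
      (fun x : (logShells X logv Aut Ism hAut hIsm).Packet j vQ => factorMapDH X hlog j vQ x) ⁻¹'
        hullSet (factorFieldDH X hlog j vQ) (fun s => (c : factorFieldDH X hlog j vQ s)) := by
  rcases hΦ with h1 | h2
  · obtain ⟨σ, hσ⟩ := ind1_eq_permute_of_trivial X hAut hIsm hAutT j (h1 j)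
    rcases vQ with u | pp
    · rw [hσ (.inl u)]
      haveI := subsingleton_factorFieldDH_inl X hlog j u
      exact image_preimage_of_subsingleton _ _ ((logShells X logv Aut Ism hAut hIsm).permute j (.inl u) σ).toEquiv
    · rw [hσ (.inr pp)]
      exact permute_image_hullSet_natCast₀ X hlog Aut Ism hAut hIsm j pp c σ
  · rcases vQ with u | pp
    · obtain ⟨g, hg, hΦj⟩ := h2 j (.inl u)
      rw [hΦj]
      haveI := subsingleton_factorFieldDH_inl X hlog j u
      exact image_preimage_of_subsingleton _ _
        ((logShells X logv Aut Ism hAut hIsm).factorwise j (.inl u)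
          (fun i => (logShells X logv Aut Ism hAut hIsm).summandwise (.inl u) (g i))).toEquiv
    · obtain ⟨g, hg, hΦj⟩ := h2 j (.inr pp)
      rw [hΦj]
      exact factorwise_image_hullSet_natCast_of_unitIsm₀ X hlog hAut hIsm hIsmU j pp c g hg

end Shells

/-! ## 2. The honest setting, UNIFORMLY in the box centre `p : ℕ` (no `Fact p.Prime`; the centre is quantified AFTER the hypotheses) -/

section Honest

variable {F : Type} [Field F] [NumberField F] (X : PilotData F) {logv : PadicLogs F} (hlog : LogvAnalytic logv)
  {Aut Ism : ∀ x : Thm311.Real.Place F, Set (Carrier x ≃ₗ[ℚ] Carrier x)}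
  (hAut : ∀ x, LinearEquiv.refl ℚ (Carrier x) ∈ Aut x) (hIsm : ∀ x, LinearEquiv.refl ℚ (Carrier x) ∈ Ism x)
  (M : Type) [Field M] [NumberField M]
  (archPk : ∀ (j : (thetaIndex X).Label) (vQ : (thetaIndex X).VQ), Set ((logShells X logv Aut Ism hAut hIsm).Packet j vQ))
  (archSub : ∀ (j : (thetaIndex X).Label) (v : (thetaIndex X).V),
    Set ((logShells X logv Aut Ism hAut hIsm).Packet j ((thetaIndex X).over v)))
  (Ψ : ℤ → ∀ v : (thetaIndex X).V, v ∈ (thetaIndex X).Vbad → Set ((logShells X logv Aut Ism hAut hIsm).StarPacket v))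
  (act : ℤ → ∀ v : (thetaIndex X).V, v ∈ (thetaIndex X).Vbad →
    (logShells X logv Aut Ism hAut hIsm).StarPacket v → Module.End ℚ ((logShells X logv Aut Ism hAut hIsm).StarPacket v))
  (Mmod : ℤ → ∀ j : (thetaIndex X).LabelStar, Set ((logShells X logv Aut Ism hAut hIsm).GlobalPacket j.1))
  (region : ℤ → ∀ j : (thetaIndex X).LabelStar, FinDivisor M → ∀ vQ : (thetaIndex X).VQ,
    Set ((logShells X logv Aut Ism hAut hIsm).Packet j.1 vQ))
  (col : ℤ → Column (logShells X logv Aut Ism hAut hIsm)) (n : ℤ)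

/-- **Every element of `⟨(Ind1) ∪ (Ind2)⟩` fixes every Θ-region `e⁻¹(p·𝒪_L)` and the q-region `e⁻¹(𝒪_L)` of the honest setting, EVERY centre
`p : ℕ`** (trivial strip binder, unit-multiplication `Ism`; p449694 minus `hp.out.ne_zero`, centre after the hypotheses). [cite: DupuyHilado2025, §4.9] -/
theorem honestSetting_regions_invariant_of_unitIsm_forall_centre (hAutT : ∀ x, ∀ g ∈ Aut x, g = LinearEquiv.refl ℚ (Carrier x))
    (hIsmU : ∀ (pp : Nat.Primes) (x : (thetaIndex X).Fibre (.inr pp)), ∀ g ∈ Ism x.1,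
      haveI : Fact (pp : ℕ).Prime := ⟨pp.2⟩
      ∃ c : (presAt X hlog pp).k x, ‖c‖ = 1 ∧ ∀ a, (presAt X hlog pp).φ x (g a) = c * (presAt X hlog pp).φ x a)
    {Φ : (logShells X logv Aut Ism hAut hIsm).PacketAut}
    (hΦ : Φ ∈ Subgroup.closure
      ((logShells X logv Aut Ism hAut hIsm).Ind1Family ∪ (logShells X logv Aut Ism hAut hIsm).Ind2Family))
    (p : ℕ) (m : ℤ) (j : (thetaIndex X).Label) (vQ : (thetaIndex X).VQ) :
    Φ j vQ '' (honestSetting X hlog Aut Ism hAut hIsm M archPk archSub Ψ act Mmod region col n p).thetaRegion m j vQ =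
        (honestSetting X hlog Aut Ism hAut hIsm M archPk archSub Ψ act Mmod region col n p).thetaRegion m j vQ ∧
      Φ j vQ '' (honestSetting X hlog Aut Ism hAut hIsm M archPk archSub Ψ act Mmod region col n p).qRegion j vQ =
        (honestSetting X hlog Aut Ism hAut hIsm M archPk archSub Ψ act Mmod region col n p).qRegion j vQ := by
  have hq1 : (honestSetting X hlog Aut Ism hAut hIsm M archPk archSub Ψ act Mmod region col n p).qRegion j vQ =
      (fun x : (logShells X logv Aut Ism hAut hIsm).Packet j vQ => factorMapDH X hlog j vQ x) ⁻¹' hullSet (factorFieldDH X hlog j vQ)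
        (fun s => ((1 : ℕ) : factorFieldDH X hlog j vQ s)) := by
    simp only [Nat.cast_one]; rfl
  refine ⟨?_, ?_⟩
  · show Φ j vQ '' ((fun x : (logShells X logv Aut Ism hAut hIsm).Packet j vQ => factorMapDH X hlog j vQ x) ⁻¹'
        hullSet (factorFieldDH X hlog j vQ) (fun s => (p : factorFieldDH X hlog j vQ s))) = _
    exact PinsInhabited.image_eq_of_mem_closure (latticeSituationReal X hlog Aut Ism hAut hIsm M archPk archSub Ψ act Mmod region col) _
      (fun Φ' hΦ' => generator_image_hullSet_natCast_of_unitIsm₀ X hlog hAut hIsm hAutT hIsmU p hΦ' j vQ) hΦ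
  · rw [hq1]
    exact PinsInhabited.image_eq_of_mem_closure (latticeSituationReal X hlog Aut Ism hAut hIsm M archPk archSub Ψ act Mmod region col) _
      (fun Φ' hΦ' => generator_image_hullSet_natCast_of_unitIsm₀ X hlog hAut hIsm hAutT hIsmU 1 hΦ' j vQ) hΦ

/-- **The pins ARE INHABITED at the honest setting under unit-multiplication (Ind2), at EVERY centre `p : ℕ`** (p449694's
`exists_pinnedRegions_honestSetting_of_unitIsm` minus `Fact p.Prime`; E-t58's `PinsCriteria.exists_pinnedRegions_of_regions_invariant_of_const`
BY NAME; the witness `(ρ, qK)` is junk). [claim: Mochizuki2012, status: disputed] [cite: DupuyHilado2025, §4.9] -/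
theorem exists_pinnedRegions_honestSetting_of_unitIsm_forall_centre (hAutT : ∀ x, ∀ g ∈ Aut x, g = LinearEquiv.refl ℚ (Carrier x))
    (hIsmU : ∀ (pp : Nat.Primes) (x : (thetaIndex X).Fibre (.inr pp)), ∀ g ∈ Ism x.1,
      haveI : Fact (pp : ℕ).Prime := ⟨pp.2⟩
      ∃ c : (presAt X hlog pp).k x, ‖c‖ = 1 ∧ ∀ a, (presAt X hlog pp).φ x (g a) = c * (presAt X hlog pp).φ x a) (p : ℕ) :
    ∃ (ρ : (∀ v : (thetaIndex X).V, v ∈ (thetaIndex X).Vbad → Set ((logShells X logv Aut Ism hAut hIsm).StarPacket v)) →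
          ∀ (j : (thetaIndex X).Label) (vQ : (thetaIndex X).VQ), Set ((logShells X logv Aut Ism hAut hIsm).Packet j vQ))
      (qK : ∀ v : (thetaIndex X).V, v ∈ (thetaIndex X).Vbad → Set ((logShells X logv Aut Ism hAut hIsm).StarPacket v)),
      PinnedRegions (latticeSituationReal X hlog Aut Ism hAut hIsm M archPk archSub Ψ act Mmod region col)
        (honestSetting X hlog Aut Ism hAut hIsm M archPk archSub Ψ act Mmod region col n p) ρ qK := by
  obtain ⟨v, hv⟩ := X.S_nonempty
  have hv₀ : (Sum.inr v : Thm311.Real.Place F) ∈ (thetaIndex X).Vbad := ⟨v, hv, rfl⟩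
  obtain ⟨e, he⟩ := exists_injective_int_starPacket X Aut Ism hAut hIsm (logv := logv) (Sum.inr v : Thm311.Real.Place F)
  have hw : ∃ w : (logShells X logv Aut Ism hAut hIsm).StarPacket (Sum.inr v : Thm311.Real.Place F), w ≠ 0 := by
    by_cases h0 : e 0 = 0
    · exact ⟨e 1, fun h1 => one_ne_zero (he (h1.trans h0.symm))⟩
    · exact ⟨e 0, h0⟩
  obtain ⟨w, hw⟩ := hw
  exact PinsCriteria.exists_pinnedRegions_of_regions_invariant_of_const
    (latticeSituationReal X hlog Aut Ism hAut hIsm M archPk archSub Ψ act Mmod region col)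
    (honestSetting X hlog Aut Ism hAut hIsm M archPk archSub Ψ act Mmod region col n p) hv₀ hw
    (fun Φ hΦ m j vQ => (honestSetting_regions_invariant_of_unitIsm_forall_centre X hlog hAut hIsm M archPk archSub Ψ act Mmod region
      col n hAutT hIsmU hΦ p m j vQ).1)
    (fun Φ hΦ j vQ => (honestSetting_regions_invariant_of_unitIsm_forall_centre X hlog hAut hIsm M archPk archSub Ψ act Mmod region
      col n hAutT hIsmU hΦ p 0 j vQ).2)
    (fun m j vQ => rfl)

/-- The same at every UNIT-MULTIPLICATION binder read at the places (`g a = u·a`, `‖u‖ = 1`), EVERY centre `p : ℕ` (p449694's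
`exists_pinnedRegions_honestSetting_of_unitMultiplications` minus `Fact p.Prime`). [claim: Mochizuki2012, status: disputed] [cite: DupuyHilado2025, §4.9] -/
theorem exists_pinnedRegions_honestSetting_of_unitMultiplications_forall_centre
    (hAutT : ∀ x, ∀ g ∈ Aut x, g = LinearEquiv.refl ℚ (Carrier x))
    (hU : ∀ (v : HeightOneSpectrum (𝓞 F)), ∀ g ∈ Ism (.inr v),
      ∃ u : Carrier (.inr v : Thm311.Real.Place F), ‖u‖ = 1 ∧ ∀ a, g a = u * a) (p : ℕ) :
    ∃ (ρ : (∀ v : (thetaIndex X).V, v ∈ (thetaIndex X).Vbad → Set ((logShells X logv Aut Ism hAut hIsm).StarPacket v)) →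
          ∀ (j : (thetaIndex X).Label) (vQ : (thetaIndex X).VQ), Set ((logShells X logv Aut Ism hAut hIsm).Packet j vQ))
      (qK : ∀ v : (thetaIndex X).V, v ∈ (thetaIndex X).Vbad → Set ((logShells X logv Aut Ism hAut hIsm).StarPacket v)),
      PinnedRegions (latticeSituationReal X hlog Aut Ism hAut hIsm M archPk archSub Ψ act Mmod region col)
        (honestSetting X hlog Aut Ism hAut hIsm M archPk archSub Ψ act Mmod region col n p) ρ qK :=
  exists_pinnedRegions_honestSetting_of_unitIsm_forall_centre X hlog hAut hIsm M archPk archSub Ψ act Mmod region col n hAutT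
    (fun pp x => presented_unit_of_unitIsm X hlog hU pp x) p

end Honest

/-! ## 3. Dupuy–Hilado binders: the honest-carrier Y-26 criterion UNIFORMLY in the box centre -/

section HonestDH

variable {F : Type} [Field F] [NumberField F] (X : PilotData F) {logv : PadicLogs F} (hlog : LogvAnalytic logv)
  (M : Type) [Field M] [NumberField M]
  (archPk : ∀ (j : (thetaIndex X).Label) (vQ : (thetaIndex X).VQ), Set ((logShellsDH X logv).Packet j vQ))
  (archSub : ∀ (j : (thetaIndex X).Label) (v : (thetaIndex X).V), Set ((logShellsDH X logv).Packet j ((thetaIndex X).over v)))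
  (Ψ : ℤ → ∀ v : (thetaIndex X).V, v ∈ (thetaIndex X).Vbad → Set ((logShellsDH X logv).StarPacket v))
  (act : ℤ → ∀ v : (thetaIndex X).V, v ∈ (thetaIndex X).Vbad →
    (logShellsDH X logv).StarPacket v → Module.End ℚ ((logShellsDH X logv).StarPacket v))
  (Mmod : ℤ → ∀ j : (thetaIndex X).LabelStar, Set ((logShellsDH X logv).GlobalPacket j.1))
  (region : ℤ → ∀ j : (thetaIndex X).LabelStar, FinDivisor M → ∀ vQ : (thetaIndex X).VQ, Set ((logShellsDH X logv).Packet j.1 vQ))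
  (col : ℤ → Column (logShellsDH X logv)) (n : ℤ)

/-- **`[F:ℚ] = 1` ⟹ INHABITED AT EVERY CENTRE `p : ℕ`** (★ p525961's `exists_pinnedRegions_honestSetting_DH_of_finrank_eq_one` minus
`Fact p.Prime`, the centre quantified after `hF`: every (Ind2)-element is a norm-one unit multiplication at local degree `1`,
`IsmDHFixesEverywhere.exists_unit_mul_eq_of_mem_ismDH_of_localDeg_eq_one`). [claim: Mochizuki2012, status: disputed] [cite: DupuyHilado2025, §4.7, §4.9] -/
theorem exists_pinnedRegions_honestSetting_DH_of_finrank_eq_one_forall_centre (hF : Module.finrank ℚ F = 1) (p : ℕ) :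
    ∃ (ρ : (∀ v : (thetaIndex X).V, v ∈ (thetaIndex X).Vbad → Set ((logShellsDH X logv).StarPacket v)) →
          ∀ (j : (thetaIndex X).Label) (vQ : (thetaIndex X).VQ), Set ((logShellsDH X logv).Packet j vQ))
      (qK : ∀ v : (thetaIndex X).V, v ∈ (thetaIndex X).Vbad → Set ((logShellsDH X logv).StarPacket v)),
      PinnedRegions (latticeSituationReal X hlog stripAutDH (ismDH logv) refl_mem_stripAutDH (refl_mem_ismDH logv) M archPk
          archSub Ψ act Mmod region col)
        (honestSetting X hlog stripAutDH (ismDH logv) refl_mem_stripAutDH (refl_mem_ismDH logv) M archPk archSub Ψ act Mmod region col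
          n p) ρ qK := by
  obtain rfl := eq_analyticLogv_of_logvAnalytic hlog
  exact exists_pinnedRegions_honestSetting_of_unitMultiplications_forall_centre X hlog refl_mem_stripAutDH
    (refl_mem_ismDH (analyticLogv F)) M archPk archSub Ψ act Mmod region col n (fun _ _ hg => hg)
    (fun v _ hg => exists_unit_mul_eq_of_mem_ismDH_of_localDeg_eq_one v (localDeg_eq_one_of_finrank_eq_one hF v) hg) p

/-- **R-82 — THE HONEST-CARRIER Y-26 CRITERION, UNIFORM IN THE CENTRE: `(∀ p : ℕ, ∃ ρ qK, PinnedRegions … (honestSetting … col n p) ρ qK)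
↔ [F:ℚ] = 1`** — inhabited at EVERY centre (prime, composite, `1`, `0`) iff `F = ℚ`; EMPTY side ★ p525961's
`not_pinnedRegions_honestSetting_DH_of_one_lt_finrank` (never needed primality), read at the centre `0`. (Per-centre form at ONE `p`:
`exists_centre_…` ∘ this; modulo `[Fact p.Prime]` it is ★ p525961's declaration.) [claim: Mochizuki2012, status: disputed] [cite: DupuyHilado2025, §4.9] -/
theorem forall_centre_exists_pinnedRegions_honestSetting_DH_iff_finrank_eq_one :
    (∀ p : ℕ, ∃ (ρ : (∀ v : (thetaIndex X).V, v ∈ (thetaIndex X).Vbad → Set ((logShellsDH X logv).StarPacket v)) →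
          ∀ (j : (thetaIndex X).Label) (vQ : (thetaIndex X).VQ), Set ((logShellsDH X logv).Packet j vQ))
      (qK : ∀ v : (thetaIndex X).V, v ∈ (thetaIndex X).Vbad → Set ((logShellsDH X logv).StarPacket v)),
      PinnedRegions (latticeSituationReal X hlog stripAutDH (ismDH logv) refl_mem_stripAutDH (refl_mem_ismDH logv) M archPk
          archSub Ψ act Mmod region col)
        (honestSetting X hlog stripAutDH (ismDH logv) refl_mem_stripAutDH (refl_mem_ismDH logv) M archPk archSub Ψ act Mmod region col
          n p) ρ qK) ↔
    Module.finrank ℚ F = 1 := by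
  refine ⟨fun h => ?_, exists_pinnedRegions_honestSetting_DH_of_finrank_eq_one_forall_centre X hlog M archPk archSub Ψ act Mmod region col n⟩
  obtain ⟨ρ, qK, h0⟩ := h 0
  by_contra hne; have hpos : 0 < Module.finrank ℚ F := Module.finrank_pos
  exact not_pinnedRegions_honestSetting_DH_of_one_lt_finrank X hlog M archPk archSub Ψ act Mmod region col n 0 (by omega) ρ qK h0

/-- **… and inhabited at SOME centre iff `F = ℚ`**: `(∃ p ρ qK, PinnedRegions … p …) ↔ [F:ℚ] = 1` — so inhabitation at one centre, at
every centre, and `[F:ℚ] = 1` are all equivalent (CENTRE-INDEPENDENCE). [claim: Mochizuki2012, status: disputed] [cite: DupuyHilado2025, §4.9] -/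
theorem exists_centre_exists_pinnedRegions_honestSetting_DH_iff_finrank_eq_one :
    (∃ (p : ℕ) (ρ : (∀ v : (thetaIndex X).V, v ∈ (thetaIndex X).Vbad → Set ((logShellsDH X logv).StarPacket v)) →
          ∀ (j : (thetaIndex X).Label) (vQ : (thetaIndex X).VQ), Set ((logShellsDH X logv).Packet j vQ))
      (qK : ∀ v : (thetaIndex X).V, v ∈ (thetaIndex X).Vbad → Set ((logShellsDH X logv).StarPacket v)),
      PinnedRegions (latticeSituationReal X hlog stripAutDH (ismDH logv) refl_mem_stripAutDH (refl_mem_ismDH logv) M archPk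
          archSub Ψ act Mmod region col)
        (honestSetting X hlog stripAutDH (ismDH logv) refl_mem_stripAutDH (refl_mem_ismDH logv) M archPk archSub Ψ act Mmod region col
          n p) ρ qK) ↔
    Module.finrank ℚ F = 1 := by
  refine ⟨fun ⟨p, ρ, qK, h⟩ => ?_,
    fun hF => ⟨0, exists_pinnedRegions_honestSetting_DH_of_finrank_eq_one_forall_centre X hlog M archPk archSub Ψ act Mmod region col n hF 0⟩⟩
  by_contra hne; have hpos : 0 < Module.finrank ℚ F := Module.finrank_pos
  exact not_pinnedRegions_honestSetting_DH_of_one_lt_finrank X hlog M archPk archSub Ψ act Mmod region col n p (by omega) ρ qK h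

/-- **Three-pin form, uniform in the centre** (abc-iut-E-t42's ★ p524924 `HonestPinsLinkPin.exists_pinnedRegions3_honestSetting_iff`: the link
pin is derivable at the honest carrier's one-point context, `Fact`-free): `(∀ p, ∃ ρ qK, PinnedRegions3 …) ↔ [F:ℚ] = 1`.
[claim: Mochizuki2012, status: disputed] [cite: DupuyHilado2025, §4.7, §4.9] -/
theorem forall_centre_exists_pinnedRegions3_honestSetting_DH_iff_finrank_eq_one :
    (∀ p : ℕ, ∃ (ρ : (∀ v : (thetaIndex X).V, v ∈ (thetaIndex X).Vbad → Set ((logShellsDH X logv).StarPacket v)) →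
          ∀ (j : (thetaIndex X).Label) (vQ : (thetaIndex X).VQ), Set ((logShellsDH X logv).Packet j vQ))
      (qK : ∀ v : (thetaIndex X).V, v ∈ (thetaIndex X).Vbad → Set ((logShellsDH X logv).StarPacket v)),
      PinnedRegions3 (latticeSituationReal X hlog stripAutDH (ismDH logv) refl_mem_stripAutDH (refl_mem_ismDH logv) M archPk
          archSub Ψ act Mmod region col)
        (honestSetting X hlog stripAutDH (ismDH logv) refl_mem_stripAutDH (refl_mem_ismDH logv) M archPk archSub Ψ act Mmod region col
          n p) ρ qK) ↔
    Module.finrank ℚ F = 1 :=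
  (forall_congr' fun p => HonestPinsLinkPin.exists_pinnedRegions3_honestSetting_iff X hlog stripAutDH (ismDH logv) refl_mem_stripAutDH
      (refl_mem_ismDH logv) M archPk archSub Ψ act Mmod region col n p).trans
    (forall_centre_exists_pinnedRegions_honestSetting_DH_iff_finrank_eq_one X hlog M archPk archSub Ψ act Mmod region col n)

/-- **THE ZERO-CENTRE INSTANCE** — the honest twin of «zero Θ-idele coordinates allowed» (★ p527356): with Θ-boxes `e⁻¹(0·𝒪_L)` the honest
pins over the DH binders are STILL «INHABITED ⟺ [F:ℚ] = 1» (no prime in the statement). [claim: Mochizuki2012, status: disputed] [cite: DupuyHilado2025, §4.9] -/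
theorem exists_pinnedRegions_honestSetting_DH_zeroCentre_iff_finrank_eq_one :
    (∃ (ρ : (∀ v : (thetaIndex X).V, v ∈ (thetaIndex X).Vbad → Set ((logShellsDH X logv).StarPacket v)) →
          ∀ (j : (thetaIndex X).Label) (vQ : (thetaIndex X).VQ), Set ((logShellsDH X logv).Packet j vQ))
      (qK : ∀ v : (thetaIndex X).V, v ∈ (thetaIndex X).Vbad → Set ((logShellsDH X logv).StarPacket v)),
      PinnedRegions (latticeSituationReal X hlog stripAutDH (ismDH logv) refl_mem_stripAutDH (refl_mem_ismDH logv) M archPk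
          archSub Ψ act Mmod region col)
        (honestSetting X hlog stripAutDH (ismDH logv) refl_mem_stripAutDH (refl_mem_ismDH logv) M archPk archSub Ψ act Mmod region col
          n 0) ρ qK) ↔
    Module.finrank ℚ F = 1 :=
  ⟨fun ⟨ρ, qK, h⟩ => (exists_centre_exists_pinnedRegions_honestSetting_DH_iff_finrank_eq_one X hlog M archPk archSub Ψ act Mmod region
      col n).1 ⟨0, ρ, qK, h⟩,
    fun hF => exists_pinnedRegions_honestSetting_DH_of_finrank_eq_one_forall_centre X hlog M archPk archSub Ψ act Mmod region col n hF 0⟩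

end HonestDH

end Summit.ABC.IUTFork.Joshi.HonestPinsAnyCentre

end
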